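import Mathlib.NumberTheory.NumberField.Basic
import Mathlib.NumberTheory.NumberField.InfinitePlace.Ramification
import Mathlib.RingTheory.DedekindDomain.Ideal.Lemmas
import Mathlib.FieldTheory.IsAlgClosed.AlgebraicClosure
import Mathlib.FieldTheory.Galois.Basic
import Mathlib.FieldTheory.KrullTopology
import Mathlib.AlgebraicGeometry.EllipticCurve.Affine.Point
import Mathlib.AlgebraicGeometry.EllipticCurve.ModelsWithJ
import Literature.NumberTheory.DiophantineGeometry.LocalReduction
import Literature.NumberTheory.DiophantineGeometry.MinimalDiscriminant
import Mathlib.FieldTheory.AbelRuffini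
import Literature.IUT.HodgeTheaters.ConventionsNumbers
import Literature.IUT.HodgeTheaters.PuncturedEllipticCoverings
import HarnessLib

/-!
# [IUTchI] Definition 3.1: initial Θ-data

S. Mochizuki, *Inter-universal Teichmüller theory I*, Publ. RIMS **57** (2021) 3–207, §3,
Definition 3.1 (kurims final manuscript, May 2020, pp. 61–63) [claim: Mochizuki2012, status:
disputed]; Remarks 3.1.x: `InitialThetaDataRemarks.lean`. A DEFINITION; nothing is asserted.

**Initial Θ-data** `(F̄/F, X_F, l, C̲_K, V̲, V^bad_mod, ε̲)` subject to (a)–(f) is typed as ONE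
hypothesis structure `InitialThetaData F K Fbar E l P` over carriers (number fields `F ⊆ K`, an
algebraic closure `Fbar`, the elliptic curve `E = E_F` with `X_F = E_F ∖ {O}`, the prime `l`, the
bad-place predicates `P`), one field (group) per printed clause, clause letter in every docstring:

* (a) `F` a number field with `√−1 ∈ F`, `F̄` an algebraic closure, `G_F := Gal(F̄/F)` — REAL
  (Mathlib `NumberField`, `IsAlgClosure`, `Fbar ≃ₐ[F] Fbar`).
* (b) `X_F` = the once-punctured elliptic curve `E_F ∖ {O}`; stable reduction of `X_F` at every
  `v ∈ V(F)^non` = semistable (good or multiplicative) reduction of `E_F`, via the tree's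
  `WeierstrassCurve.IsSemistable`; `F_mod` = the field of moduli of `X_F`, DEFINED as `ℚ(j_E) ⊆ F`
  (see `fieldOfModuli`; [IUTchIV] Prop. 1.8 (ii) "the minimal field of definition … i.e., the field
  generated over `k` by the `j`-invariant"); `V_mod := V(F_mod)`; `V^bad_mod` a nonempty set of
  nonarchimedean places of
  `F_mod` of odd residue characteristic under which `E_F` has (bad) multiplicative reduction;
  `F/F_mod` Galois of degree prime to `l`; the `2·3`-torsion of `E_F` rational over `F`;
  `F_sol` = the maximal solvable extension of `F_mod` in `F̄` (`solField`, via Mathlib's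
  `solvableByRad`: in characteristic `0` an element lies in a solvable Galois extension iff it is
  solvable by radicals) — all REAL.
* (c) `l ≥ 5` prime; the image of `G_F → GL₂(𝔽_l)` on `E_F[l]` contains `SL₂(𝔽_l)` — REAL, via an
  `𝔽_l`-basis `(P, Q)` of `E_F[l](F̄)` ("every matrix of determinant `1` is realised by some
  `σ ∈ G_F`"; basis-independent since `SL₂` is normal); `K` = the fixed field of the kernel — REAL
  (a carrier type with `F → K → F̄`, pinned down by `range_K_iff`); `l` prime to the residue
  characteristics of `V^bad_mod` and to the orders of the `q`-parameters at `V(F)^bad` — REAL, with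
  `ord_v(q_v) := ord_v(Δ_min)` (Tate uniformisation as a classical FACT: at a multiplicative place
  `ord_v(q_E) = ord_v(Δ_min) = −ord_v(j_E)`, Silverman ATAEC V.5.1; [GenEll] Def. 3.3).
* (d), (f) and the `π₁`-clauses of (b): the orbicurves `C_F`, `C̲_K`, `X̲_K` of type
  `(1, l-tors)^±`, `(1, l-tors)` ([EtTh] Def. 2.1) and the cusp `ε̲` are ABSENT deep inputs; they
  enter through the INTERFACE structure `ThetaGeometry`, BUILT ON the tree: `Π_{C_F} ↠ G_F` is a
  `FundamentalExtension` (abc-iut-L4-t1) whose `gal` is identified with `Gal(F̄/F)`, and the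
  `K`-level data `(l, X_K, C̲_K, ε̲, cusps)` is a `PuncturedEllipticData` (abc-iut-L5-t1, [IUTchI]
  §1) openly embedded as `Π_{C_K} = Π_{C_F} ×_{G_F} G_K`; hence `Π_{X̲_K}, Π_{C̲_K}` and — by the
  CONSTRUCTION of Def. 1.1 (`PuncturedEllipticData.piXarrow/piCarrow`) — `Π_{X̲→_K}, Π_{C̲→_K}` are
  determined by `(X_K, C̲_K, ε̲)` as print says ((f)); the type conditions enter as the printed
  group theory ([EtTh] §2: indices `l`, `2`, geometricity). TODO-merge: abc-iut-L2-t2 ([EtTh]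
  Def. 2.1/2.3/2.5), abc-iut-L3-t2 (tempered `π₁`, Rmk 3.1.1).
* (e), (f) at `v ∈ V̲^bad`: "the hyperbolic orbicurve `C̲_v` is of type `(1, ℤ/lℤ)^±`" and "`ε̲_v` is
  the cusp that arises from the canonical generator [up to sign] `±1`" ([EtTh] Def. 2.5 (i)) are
  CARRIED as the INTERFACE predicates `P : BadPlacePredicates K` (a parameter; owner of the real
  predicates: abc-iut-L2-t2) and the fields `bad_type`, `bad_cusp`.
* (e) `V̲ ⊆ V(K)` a section of `V(K) ↠ V_mod` — REAL over the §0 vocabulary `Val` of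
  `ConventionsNumbers.lean` (`Val.restrict` is added here), with `V̲^non, V̲^arc, V̲^good, V̲^bad`.

Deliberately NOT here (recorded, not typed): the `K`-coricity of `C_K` ((d), [CanLift] Rmk 2.1.1);
the models `X̲̲_v, C̲̲_v` via `l`-th roots of the theta function and `Π_v̲ := Π^tp_{X̲̲_v̲}` at
`v̲ ∈ V̲^bad` ((e), [EtTh] §2; Rmk 3.1.1, abc-iut-L3-t2); the decomposition groups `G_v ⊆ G_K` ((e)).
EXISTENCE of initial Θ-data is printed in [IUTchIV] Cor. 2.2 (ii) and its proof, (P1)–(P7) p. 46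
("there exist data `C̲_K`, `V̲`, `ε̲` such that all of the conditions of [IUTchI], Definition 3.1,
(a)–(f), are satisfied") — not constructed here. No statement of the paper is strengthened.
-/

namespace Literature.IUT.HodgeTheaters

open NumberField IsDedekindDomain
open scoped WeierstrassCurve.Affine Classical

universe u v w uP

/-! ### Restriction of valuations (complement to §0 `Val`) -/
namespace Val
variable (L : Type u) {M : Type v} [Field L] [NumberField L] [Field M] [NumberField M] [Algebra L M]

/-- The natural surjection `V(M) ↠ V(L)` for a finite extension `L ⊆ M` of number fields:
restriction of valuations (`InfinitePlace.comap` on `V^arc`; on `V^non` the prime of `𝓞 L` below,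
`HeightOneSpectrum.under`, transported through `FinitePlace.maximalIdeal` / `FinitePlace.mk`)
([IUTchI] Def. 3.1 (e): "the natural surjection `V(K) ↠ V_mod`"). [claim: Mochizuki2012, status: disputed] -/
noncomputable def restrict : Val M → Val L :=
  Sum.map (fun w => w.comap (algebraMap L M))
    (fun w => FinitePlace.mk ((FinitePlace.maximalIdeal w).under (𝓞 L)))

end Val

/-! ### (a)–(c): the arithmetic data -/
section Arithmetic
variable {F : Type u} [Field F] (Fbar : Type w) [Field Fbar] [Algebra F Fbar]

/-- `E_F(F̄)`: the group of `F̄`-valued points of the elliptic curve `E_F` (Mathlib's nonsingular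
affine points of the base change). [claim: Mochizuki2012, status: disputed] -/
abbrev GeomPoints (E : WeierstrassCurve F) : Type w := (E.toAffine.baseChange Fbar).Point

variable {Fbar}

/-- The natural action of `σ ∈ G_F = Gal(F̄/F)` on `E_F(F̄)` (Def. 3.1 (a), (c)): Mathlib's
`Point.map` along the `F`-algebra automorphism `σ`. [claim: Mochizuki2012, status: disputed] -/
noncomputable def galoisAct (E : WeierstrassCurve F) (σ : Fbar ≃ₐ[F] Fbar) :
    GeomPoints Fbar E →+ GeomPoints Fbar E :=
  WeierstrassCurve.Affine.Point.map (σ : Fbar →ₐ[F] Fbar)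

/-- `σ ∈ G_F` acts trivially on the `l`-torsion points `E_F[l](F̄)`, i.e. `σ` lies in the kernel
of the homomorphism `G_F → GL₂(𝔽_l)` of Def. 3.1 (c). [claim: Mochizuki2012, status: disputed] -/
def FixesTorsion (E : WeierstrassCurve F) (l : ℕ) (σ : Fbar ≃ₐ[F] Fbar) : Prop :=
  ∀ P : GeomPoints Fbar E, (l : ℤ) • P = 0 → galoisAct E σ P = P

variable (Fbar) in
/-- Def. 3.1 (c), "the image of the outer homomorphism `G_F → GL₂(𝔽_l)` determined by the
`l`-torsion points of `E_F` contains the subgroup `SL₂(𝔽_l) ⊆ GL₂(𝔽_l)`", typed through an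
`𝔽_l`-basis `(P, Q)` of `E_F[l](F̄)`: `P, Q` are `l`-torsion, independent, span the `l`-torsion,
and every integer matrix `(a b; c d)` with `ad − bc ≡ 1 (mod l)` is realised by some `σ ∈ G_F`
(`σP = aP + cQ`, `σQ = bP + dQ`). Containing the normal subgroup `SL₂` does not depend on the
basis. [claim: Mochizuki2012, status: disputed] -/
@[mk_iff] structure ImageContainsSL2 (E : WeierstrassCurve F) (l : ℕ) : Prop where
  /-- an `𝔽_l`-basis of `E[l](F̄)` on which every determinant-one matrix is a Galois element -/
  exists_basis : ∃ P Q : GeomPoints Fbar E, (l : ℤ) • P = 0 ∧ (l : ℤ) • Q = 0 ∧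
    (∀ a b : ℤ, a • P + b • Q = 0 → (l : ℤ) ∣ a ∧ (l : ℤ) ∣ b) ∧
    (∀ T : GeomPoints Fbar E, (l : ℤ) • T = 0 → ∃ a b : ℤ, T = a • P + b • Q) ∧
    ∀ a b c d : ℤ, (l : ℤ) ∣ a * d - b * c - 1 →
      ∃ σ : Fbar ≃ₐ[F] Fbar, galoisAct E σ P = a • P + c • Q ∧ galoisAct E σ Q = b • P + d • Q

variable [NumberField F]

/-- `F_mod ⊆ F`, "the field of moduli of `X_F`" (Def. 3.1 (b), referring to [AbsTopIII] Def. 5.1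
(ii): the subfield of `F̄` fixed by the image of `Aut(X_{F̄})` in `Aut(F̄)`). For the once-punctured
elliptic curve `X_F = E_F ∖ {O}` an automorphism of `F̄` lifts to the scheme `X_{F̄}` iff it fixes
`j(E_F)`, so this field is `ℚ(j_E)`; [IUTchIV] Prop. 1.8 (ii): "the minimal field of definition of
`E_k̄`, i.e., the field generated over `k` by the `j`-invariant". DESIGN CHOICE: we take
`ℚ(j_E) ⊆ F` as the definition. [claim: Mochizuki2012, status: disputed] -/
noncomputable def fieldOfModuli (E : WeierstrassCurve F) [E.IsElliptic] : IntermediateField ℚ F :=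
  IntermediateField.adjoin ℚ {E.j}

/-- `F_sol ⊆ F̄`, "the maximal solvable extension of `F_mod` in `F̄`" (Def. 3.1 (b)), as a subfield
of `F̄`: in characteristic `0` an element of `F̄` lies in a finite Galois extension of `F_mod` with
solvable group iff it is solvable by radicals over `F_mod` (Galois), so we take Mathlib's
`solvableByRad F_mod F̄` (DESIGN CHOICE, recorded). [claim: Mochizuki2012, status: disputed] -/
noncomputable def solField (E : WeierstrassCurve F) [E.IsElliptic] (Fbar : Type w) [Field Fbar]
    [Algebra F Fbar] : Subfield Fbar :=
  letI : Algebra (fieldOfModuli E) Fbar :=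
    ((algebraMap F Fbar).comp (algebraMap (fieldOfModuli E) F)).toAlgebra
  (solvableByRad (fieldOfModuli E) Fbar).toSubfield

/-- `ord_v(q_v)`, the order of the `q`-parameter of `E_F` at a finite place `v` of (bad)
multiplicative reduction (Def. 3.1 (c): "the orders of the `q`-parameters of `E_F` [i.e., in the
terminology of [GenEll], Definition 3.3, the 'local heights']"). By Tate's uniformisation theorem
(classical FACT, Silverman ATAEC V.5.1; not re-proved here) `ord_v(q_E) = ord_v(Δ_min) = −ord_v(j_E)`
at such a place, and we DEFINE the quantity as the tree's `ord_v(Δ_min)`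
(`WeierstrassCurve.ordMinimalDiscriminant`). [claim: Mochizuki2012, status: disputed] -/
noncomputable def qParamOrd (E : WeierstrassCurve F) (v : HeightOneSpectrum (𝓞 F)) : ℕ :=
  E.ordMinimalDiscriminant v

end Arithmetic

/-! ### (b), (d), (f): the fundamental-group INTERFACE -/
/-- INTERFACE for the étale-fundamental-group clauses of Def. 3.1 (b), (d), (f), built on the
tree: `Π_{C_F} ↠ G_F` is a `FundamentalExtension` ([AbsTopIII]; abc-iut-L4-t1) with `gal ≅ G_F`
(the parameter, `= Gal(F̄/F)` with the Krull topology); (b) `Π_{X_F} ⊴ Π_{C_F}` open of index `2`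
surjecting onto `G_F` (`X_F → C_F` the quotient by `−1`); (d), (f) the `K`-level data
`(l, X_K, C̲_K, ε̲, …)` IS a `PuncturedEllipticData` ([IUTchI] §1, abc-iut-L5-t1) whose ambient
`Π_{C_K} ↠ G_K` is openly embedded onto `Π_{C_F} ×_{G_F} G_K` compatibly with the augmentations and
with `Π_{X_K} = Π_{X_F} ∩ Π_{C_K}`; the printed type conditions "`C̲_K` of type `(1, l-tors)^±` …
determines `X̲_K` of type `(1, l-tors)`" ([EtTh] Def. 2.1: `X̲_K → X_K` geometric of degree `l`,
`X̲_K → C̲_K` of degree `2`, `C̲_K ↛ X_K`) are the last four fields. NOT carried: `K`-coricity.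
[claim: Mochizuki2012, status: disputed] -/
structure ThetaGeometry (GF : Type w) [Group GF] [TopologicalSpace GF] (GK : Subgroup GF)
    (l : ℕ) where
  /-- (b) `Π_{C_F} ↠ G_F` with `Δ_C` its kernel: the tree's `FundamentalExtension` … -/
  extF : Literature.AnabelianGeometry.AbsoluteAnabelian.FundamentalExtension.{w}
  /-- … whose Galois group is identified with `G_F = Gal(F̄/F)` … -/
  galIso : extF.gal ≃* GF
  /-- … bicontinuously (Krull topology on `G_F`) -/
  galIso_continuous : Continuous galIso ∧ Continuous galIso.symm
  /-- (b) `Π_{X_F} ⊆ Π_{C_F}` … -/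
  PiX : Subgroup extF.arith
  /-- … open … -/
  PiX_isOpen : IsOpen (PiX : Set extF.arith)
  /-- … normal (`X_F → C_F` is the quotient by the involution `−1`) … -/
  PiX_normal : PiX.Normal
  /-- … of index `2` … -/
  PiX_index : PiX.index = 2
  /-- … and still surjecting onto `G_F` ("natural exact sequences … for `X`") -/
  aug_PiX : PiX.map extF.aug.toMonoidHom = ⊤
  /-- (d), (f) the §1 data for `k := K`: `l`, `Π_{X_K}, Π_{C̲_K} ⊆ Π_{C_K} ↠ G_K`, the cusps
  `ε⁰, ε′, ε″` (over `ε̲`), `2ε̲` — hence, by Def. 1.1, `Π_{X̲→_K} ⊆ Π_{C̲→_K}` … -/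
  pe : PuncturedEllipticData.{w}
  /-- … with the same `l` -/
  pe_l : pe.l = l
  /-- (d) `C_K := C_F ×_F K`: the open embedding `Π_{C_K} ↪ Π_{C_F}` … -/
  embK : pe.E.arith →* extF.arith
  /-- … continuous … -/
  embK_continuous : Continuous embK
  /-- … injective … -/
  embK_injective : Function.Injective embK
  /-- … with image `Π_{C_F} ×_{G_F} G_K` … -/
  embK_range : embK.range = GK.comap (galIso.toMonoidHom.comp extF.aug.toMonoidHom)
  /-- … over an identification `G_K ≅ Gal(F̄/K)` … -/
  galKIso : pe.E.gal ≃* GK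
  /-- … compatible with the augmentations -/
  aug_compat : ∀ x, galIso (extF.aug (embK x)) = ((galKIso (pe.E.aug x) : GK) : GF)
  /-- (d) `X_K := X_F ×_F K`: `Π_{X_K} = Π_{X_F} ∩ Π_{C_K}` -/
  embK_PiX : pe.PiX.map embK = PiX ⊓ embK.range
  /-- (d) "`X̲_K` of type `(1, l-tors)`": `X̲_K → X_K` has degree `l` … -/
  PiXbar_relIndex : pe.PiXbar.relIndex pe.PiX = l
  /-- … and is geometric (`Δ^ell_X → Q` surjective): `Π_{X̲_K} ↠ G_K` -/
  aug_PiXbar : Function.Surjective (pe.E.aug.toMonoidHom.comp pe.PiXbar.subtype)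
  /-- (d) `X̲_K → C̲_K` is the quotient by the inversion: index `2` … -/
  PiXbar_relIndex_PiCbar : pe.PiXbar.relIndex pe.PiCbar = 2
  /-- … and `C̲_K` is not a covering of `X_K` -/
  not_PiCbar_le_PiX : ¬ pe.PiCbar ≤ pe.PiX

/-- INTERFACE for the two LOCAL conditions of Def. 3.1 (e), (f) at `v̲ ∈ V̲^bad` ([EtTh] Def. 2.5
(i); owner of the real predicates: abc-iut-L2-t2), as predicates on `V(K)` by which
`InitialThetaData` is parametrised. [claim: Mochizuki2012, status: disputed] -/
structure BadPlacePredicates (K : Type v) [Field K] [NumberField K] where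
  /-- "the hyperbolic orbicurve `C̲_v` is of type `(1, ℤ/lℤ)^±` [cf. [EtTh], Definition 2.5, (i)]" -/
  IsTypeOneZModLPM : Val K → Prop
  /-- "`ε̲_v` is the cusp that arises from the canonical generator [up to sign] '`±1`' of the
  quotient '`ℤ̂`' that appears in the definition of a 'hyperbolic orbicurve of type `(1, ℤ/lℤ)^±`'" -/
  IsCanonicalGeneratorCusp : Val K → Prop

/-! ### Definition 3.1 -/
section Def31
variable (F : Type u) (K : Type v) (Fbar : Type w) [Field F] [NumberField F] [Field K]
  [NumberField K] [Algebra F K] [Field Fbar] [Algebra F Fbar] [Algebra K Fbar]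
  (E : WeierstrassCurve F) [E.IsElliptic] (l : ℕ) (P : BadPlacePredicates K)

/-- `G_K = Gal(F̄/K) ⊆ G_F`: the automorphisms of `F̄/F` fixing (the image of) `K` pointwise
(Def. 3.1 (e): "`G_v ⊆ G_K := Gal(F̄/K)`"). [claim: Mochizuki2012, status: disputed] -/
def galoisSubgroupOf : Subgroup (Fbar ≃ₐ[F] Fbar) where
  carrier := {σ | ∀ x : K, σ (algebraMap K Fbar x) = algebraMap K Fbar x}
  mul_mem' {σ τ} hσ hτ x := by
    change σ (τ (algebraMap K Fbar x)) = _
    rw [hτ x, hσ x]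
  one_mem' x := rfl
  inv_mem' {σ} hσ x := by
    change σ.symm (algebraMap K Fbar x) = _
    conv_lhs => rw [← hσ x]
    exact σ.symm_apply_apply _

/-- The restriction `V(K) → V(F) → V(F_mod) = V_mod` (Def. 3.1 (e): "the natural surjection
`V(K) ↠ V_mod`"). [claim: Mochizuki2012, status: disputed] -/
noncomputable def toVMod (w : Val K) : Val (fieldOfModuli E) :=
  Val.restrict (fieldOfModuli E) (Val.restrict F w)

/-- **[IUTchI] Definition 3.1 — initial Θ-data** `(F̄/F, X_F, l, C̲_K, V̲, V^bad_mod, ε̲)` relative to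
the carriers `F ⊆ K ⊆ F̄ = Fbar`, the elliptic curve `E = E_F` (so `X_F = E_F ∖ {O}`), the prime `l`
and the bad-place predicates `P` ([EtTh] Def. 2.5 (i), interface); one field (group) per printed
clause (a)–(f), pp. 61–63 (module docstring: what is REAL / INTERFACE / not carried — only the
`K`-coricity of `C_K`, the local models at bad places and `G_v`). Existence of such data is printed
in [IUTchIV] Cor. 2.2 (ii), proof (P1)–(P7) p. 46; none is constructed here.
[claim: Mochizuki2012, status: disputed] -/
structure InitialThetaData where
  /-- (a) "`F` is a number field such that `√−1 ∈ F`" (`G_F = Gal(F̄/F)` is `Fbar ≃ₐ[F] Fbar`). -/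
  sqrt_neg_one_mem : ∃ i : F, i ^ 2 = -1
  /-- (a) "`F̄` is an algebraic closure of `F`". -/
  [isAlgClosure : IsAlgClosure F Fbar]
  /-- (c) "`K ⊆ F̄`" is an extension of `F` inside `F̄`: the structure maps `F → K → F̄` and
  `F → F̄` are compatible. -/
  [isScalarTower : IsScalarTower F K Fbar]
  /-- (b) "`X_F` is a once-punctured elliptic curve … that admits stable reduction over all
  `v ∈ V(F)^non`": `E_F` is semistable (good or multiplicative reduction) at every finite place. -/
  isSemistable : E.IsSemistable (𝓞 F)
  /-- (b) "`V^bad_mod ⊆ V_mod` is a nonempty set of nonarchimedean valuations of `F_mod`" — the set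
  (of finite places, embedded in `V_mod` by `Val.non`) … -/
  VbadMod : Set (FinitePlace (fieldOfModuli E))
  /-- (b) … is nonempty … -/
  VbadMod_nonempty : VbadMod.Nonempty
  /-- (b) … "of odd residue characteristic" … -/
  VbadMod_odd : ∀ w ∈ VbadMod, Odd (residueChar w)
  /-- (b) … "such that `X_F` has bad [i.e., multiplicative] reduction at the elements of `V(F)`
  that lie over `V^bad_mod`". -/
  multiplicative_over_VbadMod : ∀ v : FinitePlace F,
    Val.restrict (fieldOfModuli E) (Val.non v) ∈ Val.non '' VbadMod →
      E.HasMultiplicativeReductionAt v.maximalIdeal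
  /-- (b) "the field extension `F/F_mod` is Galois …" -/
  isGalois_fieldOfModuli : IsGalois (fieldOfModuli E) F
  /-- (b) "… of degree prime to `l`" -/
  finrank_coprime : (Module.finrank (fieldOfModuli E) F).Coprime l
  /-- (b) "the `2·3`-torsion points of `E_F` are rational over `F`": every `F̄`-point killed by `6`
  comes from an `F`-point. -/
  torsion_six_rational : ∀ P : GeomPoints Fbar E, (6 : ℤ) • P = 0 →
    P ∈ Set.range (WeierstrassCurve.Affine.Point.baseChange (W' := E.toAffine) F Fbar)
  /-- (c) "`l` is a prime number …" -/
  l_prime : l.Prime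
  /-- (c) "… `≥ 5`" -/
  five_le_l : 5 ≤ l
  /-- (c) "the image of the outer homomorphism `G_F → GL₂(𝔽_l)` determined by the `l`-torsion
  points of `E_F` contains the subgroup `SL₂(𝔽_l)`". -/
  imageContainsSL2 : ImageContainsSL2 Fbar E l
  /-- (c) "`K ⊆ F̄` … the finite Galois extension of `F` determined by the kernel of this
  homomorphism": the image of `K` in `F̄` is exactly the fixed field of the automorphisms acting
  trivially on `E_F[l](F̄)`. -/
  range_K_iff : ∀ x : Fbar, x ∈ Set.range (algebraMap K Fbar) ↔
    ∀ σ : Fbar ≃ₐ[F] Fbar, FixesTorsion E l σ → σ x = x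
  /-- (c) "`l` is prime to the [residue characteristics of the] elements of `V^bad_mod` …" -/
  l_ne_residueChar : ∀ w ∈ VbadMod, residueChar w ≠ l
  /-- (c) "… as well as to the orders of the `q`-parameters of `E_F` at the primes of `V(F)^bad`"
  (`qParamOrd`, Tate uniformisation as FACT). -/
  l_coprime_qParamOrd : ∀ v : FinitePlace F,
    Val.restrict (fieldOfModuli E) (Val.non v) ∈ Val.non '' VbadMod →
      l.Coprime (qParamOrd E v.maximalIdeal)
  /-- (d), (f) and the `π₁`-clauses of (b): the INTERFACE `ThetaGeometry` over `G_F ⊇ G_K`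
  ("`C̲_K` is a hyperbolic orbicurve of type `(1, l-tors)^±` … with `K`-core `C_K := C_F ×_F K`";
  "`ε̲` is a cusp of `C̲_K` that arises from a nonzero element of the quotient `Q`"). -/
  geom : ThetaGeometry.{w} (Fbar ≃ₐ[F] Fbar) (galoisSubgroupOf F K Fbar) l
  /-- (e) "`V̲ ⊆ V(K)` is a subset …" -/
  V : Set (Val K)
  /-- (e) "… that induces a natural bijection `V̲ ⥲ V_mod`, i.e., a section of the natural surjection
  `V(K) ↠ V_mod`" (restriction `V(K) → V(F) → V(F_mod) = V_mod`). -/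
  V_bijOn : Set.BijOn (toVMod F K E) V Set.univ
  /-- (e) "If `v̲ ∈ V̲^bad`, then we assume further that the hyperbolic orbicurve `C̲_v̲` is of type
  `(1, ℤ/lℤ)^±`" (interface predicate). -/
  bad_type : ∀ w ∈ V, toVMod F K E w ∈ Val.non '' VbadMod → P.IsTypeOneZModLPM w
  /-- (f) "If `v̲ ∈ V̲^bad`, then we assume that `ε̲_v̲` is the cusp that arises from the canonical
  generator [up to sign] '`±1`'" (interface predicate). -/
  bad_cusp : ∀ w ∈ V, toVMod F K E w ∈ Val.non '' VbadMod → P.IsCanonicalGeneratorCusp w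

namespace InitialThetaData
variable {F K Fbar E l P} (D : InitialThetaData F K Fbar E l P)
/-- `V_mod := V(F_mod)` (Def. 3.1 (b)). [claim: Mochizuki2012, status: disputed] -/
abbrev VMod : Type u := Val (fieldOfModuli E)
/-- `V^good_mod := V_mod ∖ V^bad_mod` (Def. 3.1 (b)), as a subset of `V_mod` (archimedean places are
good). [claim: Mochizuki2012, status: disputed] -/
def VgoodMod : Set (Val (fieldOfModuli E)) := (Val.non '' D.VbadMod)ᶜ
/-- `V(F)^bad := V^bad_mod ×_{V_mod} V(F)` (Def. 3.1 (b)): finite places of `F` over `V^bad_mod`.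
[claim: Mochizuki2012, status: disputed] -/
def VFbad : Set (FinitePlace F) :=
  {v | Val.restrict (fieldOfModuli E) (Val.non v) ∈ Val.non '' D.VbadMod}
/-- `V̲^non := V̲ ∩ V(K)^non` (Def. 3.1 (e)). [claim: Mochizuki2012, status: disputed] -/
def Vnon : Set (Val K) := {w ∈ D.V | w.IsNon}
/-- `V̲^arc := V̲ ∩ V(K)^arc` (Def. 3.1 (e)). [claim: Mochizuki2012, status: disputed] -/
def Varc : Set (Val K) := {w ∈ D.V | w.IsArc}
/-- `V̲^bad := V̲ ∩ V(K)^bad`, the members of `V̲` lying over `V^bad_mod` (Def. 3.1 (e)).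
[claim: Mochizuki2012, status: disputed] -/
def Vbad : Set (Val K) := {w ∈ D.V | toVMod F K E w ∈ Val.non '' D.VbadMod}
/-- `V̲^good := V̲ ∩ V(K)^good`, the members of `V̲` lying over `V^good_mod` (Def. 3.1 (e)).
[claim: Mochizuki2012, status: disputed] -/
def Vgood : Set (Val K) := {w ∈ D.V | toVMod F K E w ∉ Val.non '' D.VbadMod}
/-- `Π_{C_F}` (Def. 3.1 (b)). [claim: Mochizuki2012, status: disputed] -/
abbrev PiC : Type w := D.geom.extF.arith
/-- `Π_{C_K} := Π_{C_F} ×_{G_F} G_K ⊆ Π_{C_F}` (Def. 3.1 (d)), the image of the embedding.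
[claim: Mochizuki2012, status: disputed] -/
def PiCK : Subgroup D.PiC := D.geom.embK.range
/-- `Π_{X_K} := Π_{X_F} ×_{G_F} G_K` (Def. 3.1 (d)). [claim: Mochizuki2012, status: disputed] -/
def PiXK : Subgroup D.PiC := D.geom.PiX ⊓ D.PiCK
/-- `Δ_C := Ker(Π_{C_F} ↠ G_F)` (Def. 3.1 (b)). [claim: Mochizuki2012, status: disputed] -/
def DeltaC : Subgroup D.PiC := D.geom.extF.geom
/-- `Δ_X := Π_{X_F} ∩ Δ_C` (Def. 3.1 (b)). [claim: Mochizuki2012, status: disputed] -/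
def DeltaX : Subgroup D.PiC := D.geom.PiX ⊓ D.DeltaC
/-- `Π_{X̲_K} ⊆ Π_{C_F}` (Def. 3.1 (d)): the image of `Π_{X̲} = Π_X ∩ Π_{C̲}` of the §1 data.
[claim: Mochizuki2012, status: disputed] -/
def PiXund : Subgroup D.PiC := D.geom.pe.PiXbar.map D.geom.embK
/-- `Π_{C̲_K} ⊆ Π_{C_F}` (Def. 3.1 (d)). [claim: Mochizuki2012, status: disputed] -/
def PiCund : Subgroup D.PiC := D.geom.pe.PiCbar.map D.geom.embK

/-- `Π_{X̲→_K} ⊆ Π_{C̲→_K} ⊆ Π_{C_F}` (Def. 3.1 (f): "the data `(X_K, C̲_K, ε̲)` determines … open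
subgroups"), via the CONSTRUCTION of Def. 1.1 (`PuncturedEllipticData.piXarrow`); for
`v̲ ∈ V̲^good`, "`Π_v̲ := Π_{X̲→_v̲}`". [claim: Mochizuki2012, status: disputed] -/
def PiXarrow : Subgroup D.PiC := D.geom.pe.piXarrow.map D.geom.embK

/-- `Π_{C̲→_K}` (Def. 3.1 (f), via Def. 1.1 `PuncturedEllipticData.piCarrow`).
[claim: Mochizuki2012, status: disputed] -/
def PiCarrow : Subgroup D.PiC := D.geom.pe.piCarrow.map D.geom.embK

/-- `Δ_{X̲} ⊆ Δ_{C̲} ⊆ Δ_C` (Def. 3.1 (f)): `Δ_{X̲} := Π_{X̲_K} ∩ Δ_C`. [claim: Mochizuki2012, status: disputed] -/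
def DeltaXund : Subgroup D.PiC := D.PiXund ⊓ D.DeltaC

/-- `Δ_{C̲} := Π_{C̲_K} ∩ Δ_C` (Def. 3.1 (f)). [claim: Mochizuki2012, status: disputed] -/
def DeltaCund : Subgroup D.PiC := D.PiCund ⊓ D.DeltaC

/-- `Δ_{X̲→} ⊆ Δ_{C̲→} ⊆ Δ_C` (Def. 3.1 (f)): `Δ_{C̲→} := Π_{C̲→_K} ∩ Δ_C`. [claim: Mochizuki2012, status: disputed] -/
def DeltaCarrow : Subgroup D.PiC := D.PiCarrow ⊓ D.DeltaC

/-- `V̲` is in bijection with `V_mod` (Def. 3.1 (e)); the inverse bijection `V_mod ⥲ V̲`,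
`v ↦ v̲` ("write `v̲ ∈ V̲` for the element of `V̲` that corresponds to `v`", Ex. 3.5 (i)).
[claim: Mochizuki2012, status: disputed] -/
noncomputable def underline (v : Val (fieldOfModuli E)) : Val K :=
  (D.V_bijOn.surjOn (Set.mem_univ v)).choose

/-- `v̲ ∈ V̲` for every `v ∈ V_mod`. [claim: Mochizuki2012, status: disputed] -/
theorem underline_mem (v : Val (fieldOfModuli E)) : D.underline v ∈ D.V :=
  (D.V_bijOn.surjOn (Set.mem_univ v)).choose_spec.1

/-- `v̲` lies over `v`. [claim: Mochizuki2012, status: disputed] -/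
theorem toVMod_underline (v : Val (fieldOfModuli E)) : toVMod F K E (D.underline v) = v :=
  (D.V_bijOn.surjOn (Set.mem_univ v)).choose_spec.2

end InitialThetaData
end Def31
end Literature.IUT.HodgeTheaters
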